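import Literature.Analysis.FluidPDE.DissipationAnomaly
import Literature.Analysis.FunctionSpaces.TorusSpaceTime
import Literature.Analysis.FunctionSpaces.TorusCalculusProofs
import Mathlib.Analysis.Calculus.MeanValue
import HarnessLib

/-!
# No Duchon–Robert defect for smooth fields: discharge of `duchonRobertApprox_smooth_tendsto_zero`

Analysis/FluidPDE proof file; sibling of `DissipationAnomaly` (the named facts
`Torus.duchonRobertApprox_smooth_tendsto_zero` and `Torus.hasDuchonRobertDefect_zero_of_smooth`:
Duchon–Robert 2000, discussion after Prop. 2 and §4 — the defect `D(u)` vanishes for fields of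
regularity better than `1/3`, a fortiori for jointly smooth `u`; Eyink 2003, §1). This file PROVES
both (`duchonRobertApprox_smooth_tendsto_zero_holds`, `hasDuchonRobertDefect_zero_of_smooth_holds`).

## The argument (Duchon–Robert 2000, p. 252: `|D_ε(u)| ≤ C ε^{3α-1}` for `u ∈ C^α`, here `α = 1`)

For a smooth slice `v : T^d → ℝ^d` with `‖Dv‖ ≤ L`, the increments satisfy `|δv(x;ξ)| ≤ L|ξ|`
(mean value inequality on the lift), so
`|D_ε(v)(x)| = ¼ |∫ ∇φ^ε(ξ)·δv |δv|² dξ| ≤ ¼ L³ ∫ |∇φ^ε(ξ)| |ξ|³ dξ = ¼ L³ ε² ∫ |∇φ(η)| |η|³ dη`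
(`∇φ^ε(ξ) = ε^{-d-1} (∇φ)(ξ/ε)` and the substitution `ξ = εη`). For `u` jointly smooth on
`[0,T] × T^d` the spatial derivatives are bounded on the compact `[0,T] × T^d`, so `L` is uniform
in `t ∈ [0,T]`, and against a bounded test function `ψ` the pairing `∫₀ᵀ∫ D_ε(u) ψ` is `O(ε²) → 0`.

## References

* J. Duchon, R. Robert, *Inertial energy dissipation for weak solutions of incompressible Euler
  and Navier–Stokes equations*, Nonlinearity 13 (2000) 249–255: (9), Prop. 2 and the discussion
  following it (p. 252), §4. [DuchonRobert2000]
* G. L. Eyink, *Local 4/5-law and energy dissipation anomaly in turbulence*, Nonlinearity 16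
  (2003) = arXiv:nlin/0208004, §1. [Eyink2003]

## Mathlib / tree

Mathlib: `Convex.norm_image_sub_le_of_norm_fderiv_le` (mean value inequality),
`Measure.integral_comp_inv_smul_of_nonneg` (Haar rescaling), `norm_integral_le_of_norm_le`,
`norm_integral_le_of_norm_le_const`, `squeeze_zero_norm'`. Tree: `DissipationAnomaly`
(`mollifierScale`, `increment`, `duchonRobertApprox`), `TorusSpaceTime`
(`IsSmoothSpaceTimeOn.partialDeriv`, `.exists_norm_le_of_isCompact`), `TorusCalculusProofs`
(`fderiv_apply_eq_sum_partialDeriv`).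
-/

noncomputable section

open MeasureTheory Set Filter Topology Function Metric
open scoped ENNReal NNReal RealInnerProductSpace ContDiff

namespace Literature.Analysis.FluidPDE.Torus

open Literature.Analysis.FunctionSpaces

variable {d : Type*} [Fintype d]

/-! ### The rescaled mollifier: gradient and the moment `∫ |∇φ^ε| |ξ|³ = ε² ∫ |∇φ| |η|³` -/

section Scaling

variable {φ : EuclideanSpace ℝ d → ℝ} {ε : ℝ}

/-- The Fréchet derivative of the rescaled mollifier: `D(φ^ε)(ξ) = ε^{-d} ε⁻¹ (Dφ)(ξ/ε)`. [folklore] -/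
theorem hasFDerivAt_mollifierScale (hφ : Differentiable ℝ φ) (ε : ℝ) (ξ : EuclideanSpace ℝ d) :
    HasFDerivAt (FluidPDE.mollifierScale ε φ)
      ((ε ^ Fintype.card d)⁻¹ • (ε⁻¹ • _root_.fderiv ℝ φ (ε⁻¹ • ξ))) ξ := by
  have h1 : HasFDerivAt (fun x : EuclideanSpace ℝ d => ε⁻¹ • x) (ε⁻¹ • ContinuousLinearMap.id ℝ _) ξ :=
    (hasFDerivAt_id ξ).const_smul ε⁻¹
  have h2 : HasFDerivAt (fun x : EuclideanSpace ℝ d => φ (ε⁻¹ • x))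
      ((_root_.fderiv ℝ φ (ε⁻¹ • ξ)).comp (ε⁻¹ • ContinuousLinearMap.id ℝ _)) ξ :=
    (hφ (ε⁻¹ • ξ)).hasFDerivAt.comp ξ h1
  have h3 := h2.const_mul ((ε ^ Fintype.card d)⁻¹)
  have e : (fun x : EuclideanSpace ℝ d => (ε ^ Fintype.card d)⁻¹ * φ (ε⁻¹ • x)) = FluidPDE.mollifierScale ε φ := by
    funext x; rw [FluidPDE.mollifierScale_apply]
  rw [e] at h3
  have e2 : (_root_.fderiv ℝ φ (ε⁻¹ • ξ)).comp (ε⁻¹ • ContinuousLinearMap.id ℝ (EuclideanSpace ℝ d)) =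
      ε⁻¹ • _root_.fderiv ℝ φ (ε⁻¹ • ξ) := by
    ext w
    simp
  rw [e2] at h3
  exact h3

/-- The norm of the gradient of the rescaled mollifier: `|∇φ^ε(ξ)| = ε^{-d} ε⁻¹ |Dφ(ξ/ε)|` for
`ε > 0`. [folklore] -/
theorem norm_gradient_mollifierScale (hφ : Differentiable ℝ φ) (hε : 0 < ε) (ξ : EuclideanSpace ℝ d) :
    ‖gradient (FluidPDE.mollifierScale ε φ) ξ‖ =
      (ε ^ Fintype.card d)⁻¹ * ε⁻¹ * ‖_root_.fderiv ℝ φ (ε⁻¹ • ξ)‖ := by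
  rw [gradient, LinearIsometryEquiv.norm_map, (hasFDerivAt_mollifierScale hφ ε ξ).fderiv, norm_smul, norm_smul,
    Real.norm_of_nonneg (inv_nonneg.2 (pow_nonneg hε.le _)), Real.norm_of_nonneg (inv_nonneg.2 hε.le), mul_assoc]

/-- The integrand of the third moment of `|∇φ^ε|` is `ε²` times the rescaling of
`η ↦ |Dφ(η)| |η|³`. [folklore] -/
theorem norm_gradient_mollifierScale_mul_cube (hφ : Differentiable ℝ φ) (hε : 0 < ε) (ξ : EuclideanSpace ℝ d) :
    ‖gradient (FluidPDE.mollifierScale ε φ) ξ‖ * ‖ξ‖ ^ 3 =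
      ε ^ 2 * FluidPDE.mollifierScale ε (fun η => ‖_root_.fderiv ℝ φ η‖ * ‖η‖ ^ 3) ξ := by
  rw [norm_gradient_mollifierScale hφ hε, FluidPDE.mollifierScale_apply, norm_smul, Real.norm_of_nonneg (inv_nonneg.2 hε.le)]
  have hε' : ε ≠ 0 := hε.ne'
  field_simp

/-- **Rescaling preserves the integral**: `∫ g^ε = ∫ g` for `ε > 0`. [folklore] -/
theorem integral_mollifierScale_eq_integral (g : EuclideanSpace ℝ d → ℝ) (hε : 0 < ε) :
    ∫ ξ, FluidPDE.mollifierScale ε g ξ = ∫ ξ, g ξ := by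
  simp only [FluidPDE.mollifierScale]
  rw [integral_const_mul, Measure.integral_comp_inv_smul_of_nonneg volume g hε.le, finrank_euclideanSpace,
    smul_eq_mul, ← mul_assoc, inv_mul_cancel₀ (pow_ne_zero _ hε.ne'), one_mul]

/-- **The third moment of the gradient of the rescaled mollifier**:
`∫ |∇φ^ε(ξ)| |ξ|³ dξ = ε² ∫ |Dφ(η)| |η|³ dη` (`ε > 0`). [folklore] -/
theorem integral_norm_gradient_mollifierScale_mul_cube (hφ : Differentiable ℝ φ) (hε : 0 < ε) :
    ∫ ξ, ‖gradient (FluidPDE.mollifierScale ε φ) ξ‖ * ‖ξ‖ ^ 3 =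
      ε ^ 2 * ∫ η, ‖_root_.fderiv ℝ φ η‖ * ‖η‖ ^ 3 := by
  simp_rw [norm_gradient_mollifierScale_mul_cube hφ hε]
  rw [integral_const_mul, integral_mollifierScale_eq_integral _ hε]

/-- The moment density `η ↦ |Dφ(η)| |η|³` of a mollifier is integrable (continuous with compact
support). [folklore] -/
theorem integrable_norm_fderiv_mul_cube (hφ : FluidPDE.IsMollifier φ) :
    Integrable (fun η : EuclideanSpace ℝ d => ‖_root_.fderiv ℝ φ η‖ * ‖η‖ ^ 3) volume := by
  refine Continuous.integrable_of_hasCompactSupport ?_ ?_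
  · exact (hφ.1.continuous_fderiv (by simp)).norm.mul (continuous_norm.pow 3)
  · exact (hφ.2.1.fderiv (𝕜 := ℝ)).norm.mul_right

/-- The rescaled moment density is integrable (`ε > 0`). [folklore] -/
theorem integrable_norm_gradient_mollifierScale_mul_cube (hφ : FluidPDE.IsMollifier φ) (hε : 0 < ε) :
    Integrable (fun ξ : EuclideanSpace ℝ d => ‖gradient (FluidPDE.mollifierScale ε φ) ξ‖ * ‖ξ‖ ^ 3) volume := by
  have hd : Differentiable ℝ φ := hφ.1.differentiable (by simp)
  simp_rw [norm_gradient_mollifierScale_mul_cube hd hε]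
  refine Integrable.const_mul ?_ _
  have h := ((integrable_norm_fderiv_mul_cube hφ).comp_smul (inv_ne_zero hε.ne')).const_mul ((ε ^ Fintype.card d)⁻¹)
  exact h

end Scaling

/-! ### Lipschitz slices have `O(ε²)` flux -/

section Slice

variable {v : UnitAddTorus d → EuclideanSpace ℝ d} {L : ℝ}

/-- **Increments of a Lipschitz slice**: if the lift of `v` is differentiable with `‖D(lift v)‖ ≤ L`,
then `|δv(x;ξ)| ≤ L|ξ|` (mean value inequality on `ℝ^d`). [folklore] -/
theorem norm_increment_le (hv : Differentiable ℝ (FunctionSpaces.Torus.lift v))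
    (hL : ∀ y, ‖_root_.fderiv ℝ (FunctionSpaces.Torus.lift v) y‖ ≤ L)
    (ξ : EuclideanSpace ℝ d) (x : UnitAddTorus d) : ‖increment v ξ x‖ ≤ L * ‖ξ‖ := by
  obtain ⟨y, rfl⟩ := FunctionSpaces.Torus.proj_surjective x
  have h := Convex.norm_image_sub_le_of_norm_fderiv_le (f := FunctionSpaces.Torus.lift v) (fun z _ => hv z) (fun z _ => hL z)
    convex_univ (mem_univ y) (mem_univ (y + ξ))
  rw [add_sub_cancel_left] at h
  have e : increment v ξ (FunctionSpaces.Torus.proj y) =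
      FunctionSpaces.Torus.lift v (y + ξ) - FunctionSpaces.Torus.lift v y := by
    rw [increment_apply, FunctionSpaces.Torus.lift_apply, FunctionSpaces.Torus.lift_apply,
      FunctionSpaces.Torus.proj_add]
  rw [e]
  exact h

/-- **The flux of a Lipschitz slice is `O(ε²)`**: with `‖D(lift v)‖ ≤ L` and a mollifier `φ`,
`|D_ε(v)(x)| ≤ ¼ L³ ε² ∫ |Dφ(η)| |η|³ dη` for `ε > 0` (Duchon–Robert 2000, p. 252, the case
`α = 1` of `|D_ε(u)| ≤ C ε^{3α-1}`). [cite: DuchonRobert2000, Prop. 2 ff. (p. 252)] -/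
theorem abs_duchonRobertApprox_le {φ : EuclideanSpace ℝ d → ℝ} (hφ : FluidPDE.IsMollifier φ) {ε : ℝ} (hε : 0 < ε)
    (hv : Differentiable ℝ (FunctionSpaces.Torus.lift v))
    (hL : ∀ y, ‖_root_.fderiv ℝ (FunctionSpaces.Torus.lift v) y‖ ≤ L) (x : UnitAddTorus d) :
    |duchonRobertApprox φ ε v x| ≤
      4⁻¹ * (L ^ 3 * (ε ^ 2 * ∫ η, ‖_root_.fderiv ℝ φ η‖ * ‖η‖ ^ 3)) := by
  have hd : Differentiable ℝ φ := hφ.1.differentiable (by simp)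
  rw [duchonRobertApprox, abs_mul, abs_of_pos (by norm_num : (0 : ℝ) < 4⁻¹)]
  refine mul_le_mul_of_nonneg_left ?_ (by norm_num)
  rw [← integral_norm_gradient_mollifierScale_mul_cube hd hε, ← integral_const_mul]
  refine (Real.norm_eq_abs _ ▸ norm_integral_le_of_norm_le
    ((integrable_norm_gradient_mollifierScale_mul_cube hφ hε).const_mul (L ^ 3)) (Eventually.of_forall fun ξ => ?_))
  have hinc := norm_increment_le hv hL ξ x
  calc ‖⟪gradient (FluidPDE.mollifierScale ε φ) ξ, increment v ξ x⟫ * ‖increment v ξ x‖ ^ 2‖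
      = |⟪gradient (FluidPDE.mollifierScale ε φ) ξ, increment v ξ x⟫| * ‖increment v ξ x‖ ^ 2 := by
        rw [norm_mul, Real.norm_eq_abs, Real.norm_of_nonneg (sq_nonneg _)]
    _ ≤ (‖gradient (FluidPDE.mollifierScale ε φ) ξ‖ * ‖increment v ξ x‖) * ‖increment v ξ x‖ ^ 2 :=
        mul_le_mul_of_nonneg_right (abs_real_inner_le_norm _ _) (sq_nonneg _)
    _ = ‖gradient (FluidPDE.mollifierScale ε φ) ξ‖ * ‖increment v ξ x‖ ^ 3 := by ring
    _ ≤ ‖gradient (FluidPDE.mollifierScale ε φ) ξ‖ * (L * ‖ξ‖) ^ 3 := by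
        gcongr
    _ = L ^ 3 * (‖gradient (FluidPDE.mollifierScale ε φ) ξ‖ * ‖ξ‖ ^ 3) := by ring

end Slice

/-! ### Uniform Lipschitz bounds for jointly smooth fields on `[0,T] × T^d` -/

section Uniform

variable {T : ℝ} {u : ℝ → UnitAddTorus d → EuclideanSpace ℝ d}

/-- **Jointly smooth fields on `[0,T] × T^d` are uniformly Lipschitz in space**: there is `L ≥ 0`
with `‖D(lift (u t))(y)‖ ≤ L` for all `t ∈ [0,T]` and `y ∈ ℝ^d` (each `∂ᵢu` is jointly smooth,
hence bounded on the compact `[0,T] × T^d`, and `D(u t) w = Σᵢ wᵢ ∂ᵢ(u t)`). [folklore] -/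
theorem exists_norm_fderiv_lift_le (hT : 0 < T) (hu : FunctionSpaces.Torus.IsSmoothSpaceTimeOn (Icc 0 T) u) :
    ∃ L : ℝ, 0 ≤ L ∧ ∀ t ∈ Icc 0 T, ∀ y : EuclideanSpace ℝ d,
      ‖_root_.fderiv ℝ (FunctionSpaces.Torus.lift (u t)) y‖ ≤ L := by
  classical
  have hS : UniqueDiffOn ℝ (Icc 0 T) := uniqueDiffOn_Icc hT
  choose C hC using fun i : d =>
    (hu.partialDeriv hS i).exists_norm_le_of_isCompact isCompact_Icc subset_rfl
  have hC0 : ∀ i, 0 ≤ C i := fun i => (norm_nonneg _).trans (hC i 0 ⟨le_rfl, hT.le⟩ 0)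
  refine ⟨∑ i, C i, Finset.sum_nonneg fun i _ => hC0 i, fun t ht y => ?_⟩
  have h1 : FunctionSpaces.Torus.IsContDiff 1 (u t) := (hu.isSmooth_slice ht).isContDiff (by simp)
  refine ContinuousLinearMap.opNorm_le_bound _ (Finset.sum_nonneg fun i _ => hC0 i) fun w => ?_
  rw [FunctionSpaces.Torus.fderiv_lift, FunctionSpaces.Torus.fderiv_apply_eq_sum_partialDeriv h1, Finset.sum_mul]
  refine (norm_sum_le _ _).trans (Finset.sum_le_sum fun i _ => ?_)
  rw [norm_smul]
  calc ‖w i‖ * ‖FunctionSpaces.Torus.partialDeriv i (u t) (FunctionSpaces.Torus.proj y)‖ ≤ ‖w‖ * C i :=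
        mul_le_mul (PiLp.norm_apply_le w i) (hC i t ht _) (norm_nonneg _) (norm_nonneg _)
    _ = C i * ‖w‖ := mul_comm _ _

end Uniform

/-! ### The discharges -/

section Discharge

variable {T : ℝ} {u : ℝ → UnitAddTorus d → EuclideanSpace ℝ d}

/-- **Discharge of `Torus.duchonRobertApprox_smooth_tendsto_zero`**: for `u` jointly smooth on
`[0,T] × T^d`, every mollifier `φ` and every test function `ψ` supported in `(0,T)`,
`∫₀ᵀ∫ D_ε(u) ψ → 0` as `ε → 0⁺` — indeed `|∫₀ᵀ∫ D_ε(u) ψ| ≤ ¼ L³ (∫|Dφ||η|³) (sup|ψ|) T ε²`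
(Duchon–Robert 2000, discussion after Prop. 2, p. 252). [cite: DuchonRobert2000, Prop. 2 ff. (p. 252)] -/
theorem duchonRobertApprox_smooth_tendsto_zero_holds :
    duchonRobertApprox_smooth_tendsto_zero (T := T) (u := u) := by
  intro hu φ hφ ψ hψ
  rcases le_or_gt T 0 with hT | hT
  · simp only [Ioo_eq_empty_of_le hT, Measure.restrict_empty, integral_zero_measure]
    exact tendsto_const_nhds
  -- uniform Lipschitz bound in space and a bound for the test function on `[0,T]`
  obtain ⟨L, hL0, hL⟩ := exists_norm_fderiv_lift_le hT hu
  have hψsm : FunctionSpaces.Torus.IsSmoothSpaceTimeOn (Icc 0 T) ψ :=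
    FunctionSpaces.Torus.isSmoothSpaceTimeOn_of_contDiff hψ.1.1 (Icc 0 T)
  obtain ⟨Cψ, hCψ⟩ := hψsm.exists_norm_le_of_isCompact isCompact_Icc subset_rfl
  have hCψ0 : 0 ≤ Cψ := (norm_nonneg _).trans (hCψ 0 ⟨le_rfl, hT.le⟩ 0)
  set M : ℝ := ∫ η, ‖_root_.fderiv ℝ φ η‖ * ‖η‖ ^ 3 with hM
  have hM0 : 0 ≤ M := integral_nonneg fun η => mul_nonneg (norm_nonneg _) (pow_nonneg (norm_nonneg _) _)
  -- the `O(ε²)` bound of the pairing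
  have hbound : ∀ ε : ℝ, 0 < ε →
      ‖∫ t in Ioo 0 T, ∫ x, duchonRobertApprox φ ε (u t) x * ψ t x‖ ≤ (4⁻¹ * (L ^ 3 * M) * Cψ * T) * ε ^ 2 := by
    intro ε hε
    have hslice : ∀ t ∈ Ioo 0 T, ‖∫ x, duchonRobertApprox φ ε (u t) x * ψ t x‖ ≤ 4⁻¹ * (L ^ 3 * (ε ^ 2 * M)) * Cψ := by
      intro t ht
      have ht' : t ∈ Icc 0 T := Ioo_subset_Icc_self ht
      have hv : Differentiable ℝ (FunctionSpaces.Torus.lift (u t)) := (hu.isSmooth_slice ht').differentiable (by simp)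
      have h := norm_integral_le_of_norm_le_const (μ := (volume : Measure (UnitAddTorus d)))
        (f := fun x => duchonRobertApprox φ ε (u t) x * ψ t x) (C := 4⁻¹ * (L ^ 3 * (ε ^ 2 * M)) * Cψ)
        (Eventually.of_forall fun x => by
          rw [norm_mul, Real.norm_eq_abs]
          exact mul_le_mul (abs_duchonRobertApprox_le hφ hε hv (hL t ht') x) (hCψ t ht' x) (norm_nonneg _)
            (by positivity))
      rwa [probReal_univ, mul_one] at h
    have h2 := norm_integral_le_of_norm_le_const (μ := (volume : Measure ℝ).restrict (Ioo 0 T))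
      (f := fun t => ∫ x, duchonRobertApprox φ ε (u t) x * ψ t x) (C := 4⁻¹ * (L ^ 3 * (ε ^ 2 * M)) * Cψ)
      ((ae_restrict_mem measurableSet_Ioo).mono fun t ht => hslice t ht)
    rw [measureReal_restrict_apply_univ, Real.volume_real_Ioo_of_le hT.le, sub_zero] at h2
    refine h2.trans (le_of_eq ?_)
    ring
  -- squeeze
  refine squeeze_zero_norm' (eventually_nhdsWithin_of_forall fun ε hε => hbound ε hε) ?_
  have hc : Tendsto (fun ε : ℝ => (4⁻¹ * (L ^ 3 * M) * Cψ * T) * ε ^ 2) (𝓝 0) (𝓝 ((4⁻¹ * (L ^ 3 * M) * Cψ * T) * 0 ^ 2)) :=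
    ((continuous_const.mul (continuous_pow 2)).tendsto 0)
  rw [zero_pow two_ne_zero, mul_zero] at hc
  exact hc.mono_left nhdsWithin_le_nhds

/-- **Discharge of `Torus.hasDuchonRobertDefect_zero_of_smooth`**: smooth fields have zero
Duchon–Robert defect. [cite: DuchonRobert2000, Prop. 2 ff. (p. 252)] -/
theorem hasDuchonRobertDefect_zero_of_smooth_holds :
    hasDuchonRobertDefect_zero_of_smooth (T := T) (u := u) :=
  fun hu _ hφ _ hψ => duchonRobertApprox_smooth_tendsto_zero_holds hu hφ hψ

end Discharge

end Literature.Analysis.FluidPDE.Torus
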